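import Summits.QuantumFields.YangMills.Theorems.BalabanUVNodesN15BackgroundCovariantEntries
import HarnessLib

/-!
# THE COVARIANT (3.42) ENTRY 2 `X∘∇*_{U′}` — the ADJOINT covariant derivative applied to the test 1-form BEFORE the dressed propagator — as a RIGHT-dressing of the lineage's by-parts
# entry 2 and entry 0, its identification, and its η-defect letter (dag-n15-c g10, FILE 36; Track-A node N15 = NE2, s1 «background-layer OPERATOR ingredient»)

`--kind definition --supports stmt-QuantumFields-20544 --as helper` (K3⁷; count-neutral).  Imports BY NAME this seat's FILE 33 `…BackgroundCovariantEntries` (`hasMaj_idef_mmulOp_comp_left`,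
`dressedV`; through it FILE 28 `covD`∕`fdiffN_liftMap_eq_fgrad`, FILE 18 ★★ `e0_comp_fgradAdj_eq_e2ByParts_matrix₂`, FILE 19 `e2OpMBP₂`, FILE 2 `E2Unit`, M1 `bgPairM`, n15-b `mmulOp` ∕
`hasMaj_mmulOp` ∕ `hasMaj_idef_mmulOp`, FILE 1 `fgradAdj` ∕ `injJ`, [B11] `HasMaj` ∕ `hasMaj_comp`, `T4EtaRateDefect.idef_comp`); nothing in the tree is modified.

WHY.  [Balaban1985BackgroundPropagators] (3.42) p. 397, third entry: `|(G(U)∇*_Uλ)(x)|` — the ADJOINT covariant derivative acts on the test function `λ`, then the propagator.  In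
coordinates `e : 𝔄 ≃ ℝ^ι` orthonormal for the invariant form the adjoint of Bałaban's `D^η_{R,s} = M_R∘∇_s + M_{η⁻¹(R−1)}` (n15-b `covD`) w.r.t. `Σ_x⟨·,·⟩` is the TRANSPOSE
`(D^η_{R,s})ᵀ = ∇*_s∘M_{Rᵀ} + M_{(η⁻¹(R−1))ᵀ}` (`∇*_s = fgradAdj`, the transpose of the translation is its inverse).  Hence `X∘(D^η)ᵀ = (X∇*)∘M_{Rᵀ} + X∘M_{aᵀ}` — RIGHT-dressings of the by-parts
entry 2 `X∇* = E₂∘ι_ν` (FILE 18 ★★) and of entry 0 by DIAGONAL operators; the η-defect follows by the Leibniz rule with the diagonal factor on the right.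

WHAT.  §1 `covDT` (def: the transpose-adjoint covariant derivative), ★ `sum_mul_covD_eq_sum_covDT_mul` (ADJOINTNESS in the kernel: `Σ_p (D^η f)(p)·g(p) = Σ_p f(p)·((D^η)ᵀg)(p)` on any finite
carrier), `rowSum_transpose_le` (rows of `Cᵀ` `≤ |ι|·a` from rows of `C` `≤ a`), ★ `hasMaj_idef_comp_mmulOp_right` (the right-diagonal Leibniz letter).  §2 def `covEntry2` (`(E₂∘ι_ν)∘M_{(1+ηA⁺_ν)ᵀ}
+ X∘M_{(A⁺_ν)ᵀ}`), ★★ `dressed_comp_covDT_eq_covEntry2` (`X∘(D^η_{1+ηA⁺_ν,τ_ν})ᵀ = covEntry2` under the two unit hypotheses of FILE 18), ★★ `hasMaj_idef_covEntry2` (the η-defect letter from the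
by-parts entry-2 majorant and defect, the entry-0 majorant and defect, the rows `≤ a` and fits `≤ o` of `A⁺_ν`, the transport fit `≤ o_R`).

HONEST FRAMING.  Algebra + bookkeeping; TRANSPOSE = Bałaban's adjoint exactly when the coordinates `e` are orthonormal for the invariant form on `𝔤` (model-level, as the whole `𝔤 ↦ 𝔄`-with-
coordinates reading); letters are hypotheses here (discharged on the torus in the sequel); `U ≡ 1` chart; `DRD*`, `aQ*Q` at `U ≡ 1`; NE2⁺ NOT PRINTED; count-neutral; N15 NOT discharged;
one finite torus at fixed ε — NOT ℝ⁴, NOT infinite volume, NOT OS, NOT a mass gap, NOT Clay.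
-/

noncomputable section

open scoped BigOperators Matrix
open Finset

namespace Summit.QuantumFields.YangMills.BalabanUVNodes.N15.BackgroundLayer

open Literature.MathematicalPhysics.QuantumFieldTheory.Balaban1983to89
open Literature.MathematicalPhysics.QuantumFieldTheory.Balaban1983to89.B11SectG (BlockNorm HasMaj hasMaj_comp)
open Literature.MathematicalPhysics.QuantumFieldTheory.Balaban1983to89.T4EtaRateDefect (idef idef_apply idef_comp idef_add idef_sub)
open Literature.MathematicalPhysics.QuantumFieldTheory.Balaban1983to89.T4EtaRateCoeffDefect (pull pull_apply diagK diagK_nonneg)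
open Summit.QuantumFields.YangMills.BalabanUVNodes.N15.DerivDefect (fdiffN fdiffN_apply sum_diagK_mul sum_mul_diagK)
open Summit.QuantumFields.YangMills.BalabanUVNodes.N15.MatrixSpecies (mmulOp mmulOp_apply liftMap liftBlk liftEquiv liftEquiv_apply liftEquiv_symm_apply covD covD_apply hasMaj_mmulOp
  hasMaj_idef_mmulOp)

/-! ## §1 The transpose-adjoint covariant derivative; the right-diagonal Leibniz letter -/

section Adjoint

variable {X ι : Type} [Fintype ι] [DecidableEq ι]

/-- **THE TRANSPOSE-ADJOINT COVARIANT DERIVATIVE** `(D^η_{R,s})ᵀ = ∇*_s∘M_{Rᵀ} + M_{(η⁻¹(R − 1))ᵀ}` on the product carrier (`∇*_s = fgradAdj η⁻¹ s`, the transpose of `pull s` being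
`pull s⁻¹`) — Bałaban's `∇*_U` of (3.42) in coordinates orthonormal for the invariant form. [cite: Balaban1985BackgroundPropagators, (3.42) p.397 (entry «G(U)∇*_U λ») + (3.50) p.400] -/
def covDT (η : ℝ) (R : X → Matrix ι ι ℝ) (s : X ≃ X) : (X × ι → ℝ) →ₗ[ℝ] (X × ι → ℝ) :=
  fgradAdj η⁻¹ (liftEquiv s ι) ∘ₗ mmulOp (fun x => (R x)ᵀ) + mmulOp (fun x => (η⁻¹ • (R x - 1))ᵀ)

variable [Fintype X] [DecidableEq X]

omit [DecidableEq ι] [DecidableEq X] in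
/-- Adjointness of a matrix multiplication operator: `Σ_p (M_C f)(p)g(p) = Σ_p f(p)(M_{Cᵀ} g)(p)`. [folklore] -/
theorem sum_mmulOp_mul_eq (C : X → Matrix ι ι ℝ) (f g : X × ι → ℝ) : ∑ p, mmulOp C f p * g p = ∑ p, f p * mmulOp (fun x => (C x)ᵀ) g p := by
  simp only [mmulOp_apply, Matrix.transpose_apply, Finset.sum_mul, Finset.mul_sum]
  rw [Fintype.sum_prod_type, Fintype.sum_prod_type]
  refine Finset.sum_congr rfl fun x _ => ?_
  rw [Finset.sum_comm]
  exact Finset.sum_congr rfl fun j _ => Finset.sum_congr rfl fun i _ => by ring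

omit [DecidableEq ι] [DecidableEq X] in
/-- Adjointness of the translation: `Σ_p f(s p)g(p) = Σ_p f(p)g(s⁻¹ p)`. [folklore] -/
theorem sum_pull_mul_eq (s : X ≃ X) (f g : X × ι → ℝ) : ∑ p, f (liftEquiv s ι p) * g p = ∑ p, f p * g ((liftEquiv s ι).symm p) := by
  rw [← (liftEquiv s ι).sum_comp (fun p => f p * g ((liftEquiv s ι).symm p))]
  simp only [Equiv.symm_apply_apply]

omit [DecidableEq X] in
/-- ★ **ADJOINTNESS IN THE KERNEL**: `Σ_p (D^η_{R,s} f)(p)·g(p) = Σ_p f(p)·((D^η_{R,s})ᵀ g)(p)` — `covDT` IS the adjoint of n15-b's `covD` for the coordinate dot product on the finite carrier.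
[cite: Balaban1985BackgroundPropagators, (3.42) p.397 (∇*_U: the adjoint covariant derivative)] -/
theorem sum_mul_covD_eq_sum_covDT_mul (η : ℝ) (R : X → Matrix ι ι ℝ) (s : X ≃ X) (f g : X × ι → ℝ) :
    ∑ p, covD η R s f p * g p = ∑ p, f p * covDT η R s g p := by
  have h1 : ∀ p, covD η R s f p = mmulOp R (fdiffN η (liftMap s ι) f) p + mmulOp (fun x => η⁻¹ • (R x - 1)) f p := fun p => rfl
  have h2 : ∀ p, covDT η R s g p = fgradAdj η⁻¹ (liftEquiv s ι) (mmulOp (fun x => (R x)ᵀ) g) p + mmulOp (fun x => (η⁻¹ • (R x - 1))ᵀ) g p := fun p => rfl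
  simp only [h1, h2, add_mul, mul_add, Finset.sum_add_distrib]
  congr 1
  · rw [sum_mmulOp_mul_eq]
    have h3 : ∀ p, fdiffN η (liftMap s ι) f p = η⁻¹ * (f (liftEquiv s ι p) - f p) := fun p => by rw [fdiffN_apply, liftEquiv_apply]
    simp only [h3, fgradAdj_apply]
    have h4 : ∑ p, η⁻¹ * (f (liftEquiv s ι p) - f p) * mmulOp (fun x => (R x)ᵀ) g p =
        η⁻¹ * (∑ p, f (liftEquiv s ι p) * mmulOp (fun x => (R x)ᵀ) g p) - η⁻¹ * ∑ p, f p * mmulOp (fun x => (R x)ᵀ) g p := by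
      rw [Finset.mul_sum, Finset.mul_sum, ← Finset.sum_sub_distrib]
      exact Finset.sum_congr rfl fun p _ => by ring
    rw [h4, sum_pull_mul_eq, Finset.mul_sum, Finset.mul_sum, ← Finset.sum_sub_distrib]
    exact Finset.sum_congr rfl fun p _ => by ring
  · exact sum_mmulOp_mul_eq _ f g

omit [Fintype X] [DecidableEq X] [DecidableEq ι] in
/-- ROWS OF A TRANSPOSE: rows of `|C|` `≤ a` ⟹ rows of `|Cᵀ|` `≤ |ι|·a` (each column entry is at most its row's sum). [folklore] -/
theorem rowSum_transpose_le {C : Matrix ι ι ℝ} {a : ℝ} (hC : ∀ i, ∑ j, |C i j| ≤ a) (i : ι) : ∑ j, |Cᵀ i j| ≤ Fintype.card ι * a := by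
  calc ∑ j, |Cᵀ i j| = ∑ j, |C j i| := by simp only [Matrix.transpose_apply]
    _ ≤ ∑ j, ∑ k, |C j k| := Finset.sum_le_sum fun j _ => Finset.single_le_sum (fun k _ => abs_nonneg (C j k)) (Finset.mem_univ i)
    _ ≤ ∑ _j : ι, a := Finset.sum_le_sum fun j _ => hC j
    _ = Fintype.card ι * a := by rw [Finset.sum_const, Finset.card_univ, nsmul_eq_mul]

end Adjoint

section Leibniz

variable {X X' ι : Type} [Fintype X] [Fintype X'] [Fintype ι] {g : B6.Geometry} (blk : X → g.Site) (π : X' → X)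

/-- ★ **THE RIGHT-DIAGONAL LEIBNIZ LETTER**: `𝔇(E′M_{C′}, EM_C) = E′𝔇(M_{C′},M_C) + 𝔇(E′,E)M_C ≤ (β′o + mα)e^{−ρd}` from the fine majorant `E′ ≤ β′e^{−ρd}`, the fit `≤ o`, the defect
`𝔇(E′,E) ≤ me^{−ρd}` and the COARSE rows `≤ α` of `C`. [cite: Balaban1984PropagatorsII, (2.52)–(2.55) p.232 (composition of majorants)] -/
theorem hasMaj_idef_comp_mmulOp_right {C' : X' → Matrix ι ι ℝ} {C : X → Matrix ι ι ℝ} {E' : (X' × ι → ℝ) →ₗ[ℝ] (X' × ι → ℝ)} {E : (X × ι → ℝ) →ₗ[ℝ] (X × ι → ℝ)}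
    {α o m β' ρ : ℝ} (hα : 0 ≤ α) (ho : 0 ≤ o) (hm : 0 ≤ m) (hβ' : 0 ≤ β') (hC : ∀ x i, ∑ j, |C x i j| ≤ α) (hfit : ∀ x' i, ∑ j, |C' x' i j - C (π x') i j| ≤ o)
    (hE' : HasMaj (BlockNorm.ofBlocks g (liftBlk (blk ∘ π) ι)) (BlockNorm.ofBlocks g (liftBlk (blk ∘ π) ι)) E' (fun y y' => β' * Real.exp (-(ρ * g.dist y y'))))
    (hDE : HasMaj (BlockNorm.ofBlocks g (liftBlk blk ι)) (BlockNorm.ofBlocks g (liftBlk (blk ∘ π) ι)) (idef (pull (liftMap π ι)) (pull (liftMap π ι)) E' E)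
      (fun y y' => m * Real.exp (-(ρ * g.dist y y')))) :
    HasMaj (BlockNorm.ofBlocks g (liftBlk blk ι)) (BlockNorm.ofBlocks g (liftBlk (blk ∘ π) ι))
      (idef (pull (liftMap π ι)) (pull (liftMap π ι)) (E' ∘ₗ mmulOp C') (E ∘ₗ mmulOp C)) (fun y y' => (β' * o + m * α) * Real.exp (-(ρ * g.dist y y'))) := by
  rw [idef_comp (pull (liftMap π ι)) (pull (liftMap π ι)) (pull (liftMap π ι))]
  have hM := hasMaj_mmulOp (g := g) blk (m := fun _ => α) (fun _ => hα) hC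
  have hDM := hasMaj_idef_mmulOp (g := g) (ι := ι) blk π (o := fun _ => o) (fun _ => ho) hfit
  have h1 := hasMaj_comp hE' hDM fun _ _ => mul_nonneg hβ' (Real.exp_nonneg _)
  have h2 := hasMaj_comp hDE hM fun _ _ => mul_nonneg hm (Real.exp_nonneg _)
  refine (h1.add h2).mono fun y y' => le_of_eq ?_
  have hκ1 : (BlockNorm.ofBlocks g (liftBlk (blk ∘ π) ι)).κ = 1 := rfl
  have hκ2 : (BlockNorm.ofBlocks g (liftBlk blk ι)).κ = 1 := rfl
  simp only [hκ1, hκ2, one_mul]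
  rw [sum_mul_diagK, sum_mul_diagK]
  ring

end Leibniz

/-! ## §2 The covariant entry 2 as a right-dressing, its identification and its defect letter -/

section Entry2

variable {X J ι : Type} [Fintype X] [Fintype J] [Fintype ι] [DecidableEq X] [DecidableEq J] [DecidableEq ι] (τ : J → X ≃ X)

/-- **THE COVARIANT ENTRY 2** `X∘(D^η_{1+ηA⁺_ν, τ_ν})ᵀ` on the lineage's objects: the by-parts entry 2 `E₂∘ι_ν` (`= X∇*_ν`, FILE 18 ★★) right-dressed by `M_{(1+ηA⁺_ν)ᵀ}`, plus entry 0
right-dressed by `M_{(A⁺_ν)ᵀ}`. [cite: Balaban1985BackgroundPropagators, (3.42) p.397 (entry «G(U)∇*_U λ») + (3.50) p.400] -/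
def covEntry2 (η n : ℝ) (G : (X × ι → ℝ) →ₗ[ℝ] (X × ι → ℝ)) (D : J ⊕ J → (X × ι → ℝ) →ₗ[ℝ] (X × ι → ℝ)) (C : X → Matrix ι ι ℝ) (A : J ⊕ J → X → Matrix ι ι ℝ) (ν : J) :
    (X × ι → ℝ) →ₗ[ℝ] (X × ι → ℝ) :=
  (e2OpMBP₂ τ n G D C A ∘ₗ injJ ν) ∘ₗ mmulOp (fun x => (1 + η • A (Sum.inl ν) x)ᵀ) + (projO none ∘ₗ bgPairM G D C A) ∘ₗ mmulOp (fun x => (A (Sum.inl ν) x)ᵀ)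

variable (n : ℝ) (G : (X × ι → ℝ) →ₗ[ℝ] (X × ι → ℝ)) {D : J ⊕ J → (X × ι → ℝ) →ₗ[ℝ] (X × ι → ℝ)} (C : X → Matrix ι ι ℝ) (A : J ⊕ J → X → Matrix ι ι ℝ)

/-- ★★ **`X∘(D^η_{1+ηA⁺_ν, τ_ν})ᵀ = covEntry2`** under the two unit hypotheses of FILE 18 (`η = n⁻¹ ≠ 0`; `X∇*_ν = E₂ι_ν` by FILE 18 ★★, `(η⁻¹(R − 1))ᵀ = (A⁺_ν)ᵀ` for `R = 1 + ηA⁺_ν`).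
[cite: Balaban1985BackgroundPropagators, (3.42) p.397 + (3.50) p.400 + (3.64)–(3.65) p.402] -/
theorem dressed_comp_covDT_eq_covEntry2 (hn : n ≠ 0) (hDf : ∀ μ, D (Sum.inl μ) = fgrad n (liftEquiv (τ μ) ι) ∘ₗ G) (hDb : ∀ μ, D (Sum.inr μ) = bgrad n (liftEquiv (τ μ) ι) ∘ₗ G)
    (hunit : IsUnit (1 - LinearMap.toMatrix' (stack G D ∘ₗ unstackM C A)))
    (hunit2 : E2Unit (krowOf (fun ν => G ∘ₗ fgradAdj n (liftEquiv (τ ν) ι)) (fun μ => pull (liftEquiv (τ μ) ι)) (fun μ => mmulOp (A (Sum.inl μ) ∘ ⇑(τ μ).symm))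
      (fun μ => mmulOp (A (Sum.inr μ) ∘ ⇑(τ μ))))) (ν : J) :
    (projO none ∘ₗ bgPairM G D C A) ∘ₗ covDT n⁻¹ (fun x => 1 + n⁻¹ • A (Sum.inl ν) x) (τ ν) = covEntry2 τ n⁻¹ n G D C A ν := by
  have hcoef : (fun x => ((n⁻¹)⁻¹ • ((1 + n⁻¹ • A (Sum.inl ν) x) - 1))ᵀ) = fun x => (A (Sum.inl ν) x)ᵀ := by
    funext x
    rw [add_sub_cancel_left, smul_smul, inv_inv, mul_inv_cancel₀ hn, one_smul]
  rw [covDT, hcoef, inv_inv, LinearMap.comp_add, ← LinearMap.comp_assoc, e0_comp_fgradAdj_eq_e2ByParts_matrix₂ τ n G C A hDf hDb hunit hunit2 ν, covEntry2]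
  rfl

end Entry2

section Letters

variable {X X' J ι : Type} [Fintype X] [Fintype X'] [Fintype J] [Fintype ι] [DecidableEq X] [DecidableEq X'] [DecidableEq J] [DecidableEq ι]
  {g : B6.Geometry} (blk : X → g.Site) (π : X' → X) {τ : J → X ≃ X} {τ' : J → X' ≃ X'} {n n' : ℝ}
  {G : (X × ι → ℝ) →ₗ[ℝ] (X × ι → ℝ)} {D : J ⊕ J → (X × ι → ℝ) →ₗ[ℝ] (X × ι → ℝ)}
  {G' : (X' × ι → ℝ) →ₗ[ℝ] (X' × ι → ℝ)} {D' : J ⊕ J → (X' × ι → ℝ) →ₗ[ℝ] (X' × ι → ℝ)}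
  {C : X → Matrix ι ι ℝ} {A : J ⊕ J → X → Matrix ι ι ℝ} {C' : X' → Matrix ι ι ℝ} {A' : J ⊕ J → X' → Matrix ι ι ℝ}
  {η η' a o oR m₀ m₂ βX β₂ ρ : ℝ}

/-- ★★ **THE η-DEFECT OF THE COVARIANT ENTRY 2**: from the by-parts entry-2 fine majorant `≤ β₂e^{−ρd}` and defect `≤ m₂e^{−ρd}`, the entry-0 fine majorant `≤ β_Xe^{−ρd}` and defect
`≤ m₀e^{−ρd}`, the COARSE rows `≤ a` of `A⁺_ν` (`≤ 1 + a` of `1 + ηA⁺_ν`, `0 ≤ η ≤ 1`), the fit `≤ o` and the transport fit `≤ o_R` (all transposed: factor `|ι|`):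
`𝔇(covEntry2′, covEntry2) ≤ |ι|·(β₂o_R + m₂(1 + a) + β_Xo + m₀a)·e^{−ρd}` (§1 twice). [cite: Balaban1985BackgroundPropagators, (3.42) p.397 (shape); Balaban1984PropagatorsII, (2.52)–(2.55) p.232] -/
theorem hasMaj_idef_covEntry2 (hη0 : 0 ≤ η) (hη1 : η ≤ 1) (ha : 0 ≤ a) (ho : 0 ≤ o) (hoR : 0 ≤ oR) (hm₀ : 0 ≤ m₀) (hm₂ : 0 ≤ m₂) (hβX : 0 ≤ βX) (hβ₂ : 0 ≤ β₂) (ν : J)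
    (hA : ∀ x i, ∑ j, |A (Sum.inl ν) x i j| ≤ a) (hfA : ∀ x' i, ∑ j, |A' (Sum.inl ν) x' i j - A (Sum.inl ν) (π x') i j| ≤ o)
    (hfR : ∀ x' i, ∑ j, |(1 + η' • A' (Sum.inl ν) x') i j - (1 + η • A (Sum.inl ν) (π x')) i j| ≤ oR)
    (hE2' : HasMaj (BlockNorm.ofBlocks g (liftBlk (blk ∘ π) ι)) (BlockNorm.ofBlocks g (liftBlk (blk ∘ π) ι)) (e2OpMBP₂ τ' n' G' D' C' A' ∘ₗ injJ ν)
      (fun y y' => β₂ * Real.exp (-(ρ * g.dist y y'))))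
    (hD2 : HasMaj (BlockNorm.ofBlocks g (liftBlk blk ι)) (BlockNorm.ofBlocks g (liftBlk (blk ∘ π) ι))
      (idef (pull (liftMap π ι)) (pull (liftMap π ι)) (e2OpMBP₂ τ' n' G' D' C' A' ∘ₗ injJ ν) (e2OpMBP₂ τ n G D C A ∘ₗ injJ ν)) (fun y y' => m₂ * Real.exp (-(ρ * g.dist y y'))))
    (hX0' : HasMaj (BlockNorm.ofBlocks g (liftBlk (blk ∘ π) ι)) (BlockNorm.ofBlocks g (liftBlk (blk ∘ π) ι)) (projO none ∘ₗ bgPairM G' D' C' A')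
      (fun y y' => βX * Real.exp (-(ρ * g.dist y y'))))
    (hD0 : HasMaj (BlockNorm.ofBlocks g (liftBlk blk ι)) (BlockNorm.ofBlocks g (liftBlk (blk ∘ π) ι))
      (idef (pull (liftMap π ι)) (pull (liftMap π ι)) (projO none ∘ₗ bgPairM G' D' C' A') (projO none ∘ₗ bgPairM G D C A)) (fun y y' => m₀ * Real.exp (-(ρ * g.dist y y')))) :
    HasMaj (BlockNorm.ofBlocks g (liftBlk blk ι)) (BlockNorm.ofBlocks g (liftBlk (blk ∘ π) ι))
      (idef (pull (liftMap π ι)) (pull (liftMap π ι)) (covEntry2 τ' η' n' G' D' C' A' ν) (covEntry2 τ η n G D C A ν))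
      (fun y y' => Fintype.card ι * (β₂ * oR + m₂ * (1 + a) + (βX * o + m₀ * a)) * Real.exp (-(ρ * g.dist y y'))) := by
  have hι : (0 : ℝ) ≤ Fintype.card ι := Nat.cast_nonneg _
  have hR : ∀ x i, ∑ j, |(fun x => (1 + η • A (Sum.inl ν) x)ᵀ) x i j| ≤ Fintype.card ι * (1 + a) := by
    intro x i
    refine rowSum_transpose_le (fun i => ?_) i
    calc ∑ j, |(1 + η • A (Sum.inl ν) x) i j| ≤ ∑ j, (|(1 : Matrix ι ι ℝ) i j| + η * |A (Sum.inl ν) x i j|) := Finset.sum_le_sum fun j _ => by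
            rw [Matrix.add_apply, Matrix.smul_apply, smul_eq_mul]
            refine (abs_add_le _ _).trans (le_of_eq ?_)
            rw [abs_mul, abs_of_nonneg hη0]
      _ = ∑ j, |(1 : Matrix ι ι ℝ) i j| + η * ∑ j, |A (Sum.inl ν) x i j| := by rw [Finset.sum_add_distrib, Finset.mul_sum]
      _ ≤ 1 + 1 * a := by
          refine add_le_add (le_of_eq ?_) (mul_le_mul hη1 (hA x i) (Finset.sum_nonneg fun _ _ => abs_nonneg _) zero_le_one)
          simp only [Matrix.one_apply]
          rw [Finset.sum_eq_single i (fun j _ hj => by rw [if_neg (Ne.symm hj), abs_zero]) (fun h => absurd (Finset.mem_univ i) h), if_pos rfl, abs_one]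
      _ = 1 + a := by ring
  have hfRT : ∀ x' i, ∑ j, |(fun x' => (1 + η' • A' (Sum.inl ν) x')ᵀ) x' i j - (fun x => (1 + η • A (Sum.inl ν) x)ᵀ) (π x') i j| ≤ Fintype.card ι * oR := by
    intro x' i
    have h := rowSum_transpose_le (C := (1 + η' • A' (Sum.inl ν) x') - (1 + η • A (Sum.inl ν) (π x'))) (fun i => by simpa only [Matrix.sub_apply] using hfR x' i) i
    simpa only [Matrix.transpose_sub, Matrix.sub_apply] using h
  have hAT : ∀ x i, ∑ j, |(fun x => (A (Sum.inl ν) x)ᵀ) x i j| ≤ Fintype.card ι * a := fun x i => rowSum_transpose_le (hA x) i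
  have hfAT : ∀ x' i, ∑ j, |(fun x' => (A' (Sum.inl ν) x')ᵀ) x' i j - (fun x => (A (Sum.inl ν) x)ᵀ) (π x') i j| ≤ Fintype.card ι * o := by
    intro x' i
    have h := rowSum_transpose_le (C := A' (Sum.inl ν) x' - A (Sum.inl ν) (π x')) (fun i => by simpa only [Matrix.sub_apply] using hfA x' i) i
    simpa only [Matrix.transpose_sub, Matrix.sub_apply] using h
  have h1 := hasMaj_idef_comp_mmulOp_right blk π (by positivity) (by positivity) hm₂ hβ₂ hR hfRT hE2' hD2
  have h2 := hasMaj_idef_comp_mmulOp_right blk π (by positivity) (by positivity) hm₀ hβX hAT hfAT hX0' hD0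
  rw [covEntry2, covEntry2, idef_add]
  refine (h1.add h2).mono fun y y' => le_of_eq ?_
  ring

end Letters

end Summit.QuantumFields.YangMills.BalabanUVNodes.N15.BackgroundLayer

end
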